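import Literature.MathematicalPhysics.KineticTheory.TaggedSphereSpectralGap

/-!
# The flux pair correlation is nonpositive on the `π`-centred hyperplane

Stub `stub_fluxPairNonpos` of the swap-symmetrisation / negative-type line for the crux
`InformationPercolationEngine.SpectralContractionR` (stmt-AtomisticToContinuum-13913).

Write `M = maxwellianBeta 1`, `a₁ = collisionFrequency 1`, `ν(v - w) = ∫ ((v - w)·ω)₊ dσ(ω)`
(`integral_hardSphereKernel`). GIVEN the negative type of the flux kernel on the mass-zero
hyperplane (`∫∫ ν(v - w) φ(v) φ(w) ≤ 0` whenever `φ` is integrable with finite first moment and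
`∫ φ = 0`), we show that for `g` of finite `a₁ M`-energy with `∫ g a₁ M = 0` the flux pair
correlation `W(g) = ∫∫ ν(v - w) (M g)(v) (M g)(w)` is `≤ 0`.

Proof: put `m = ∫ M g` and `φ = M g - m M`; then `∫ φ = 0`, `φ` and `|v| φ` are integrable
(`a₁(v) ≥ c |v|`), and on `ℝ³ × ℝ³` (everything is product-integrable since
`ν(v - w) ≤ |S²| (|v| + |w|)`)
`ν φ ⊗ φ = ν (Mg) ⊗ (Mg) - m ν (Mg) ⊗ M - m ν M ⊗ (Mg) + m² ν M ⊗ M`.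
The two cross terms integrate to `∫ M g a₁ = 0` (`∫ ν(v - w) M(w) dw = a₁(v)` and the symmetry
`ν(v - w) = ν(w - v)`), the last term is `≥ 0`, so `W(g) ≤ -m² ∫∫ ν M ⊗ M ≤ 0`.
-/

noncomputable section
open MeasureTheory Metric Real Set Filter Topology
open scoped InnerProductSpace ENNReal
namespace Summit.AtomisticToContinuum.HydrodynamicLimit.Theorems.SpectralContractionRLine.FluxPair
open Literature.MathematicalPhysics.KineticTheory
open Literature.Analysis.FunctionSpaces (maxwellianBeta maxwellianBeta_one maxwellianBeta_pos)
open TaggedSphereDiffusion (collisionFrequency)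

/-- Symmetry of the flux kernel: `ν(v - w) = ν(w - v)` (`ν` only depends on the speed). [folklore] -/
theorem lorentzLossRate_sub_comm (v w : V3) :
    lorentzLossRate (v - w) = lorentzLossRate (w - v) := by
  obtain ⟨e, he⟩ := exists_norm_eq V3 zero_le_one
  rw [lorentzLossRate_eq_norm_mul he (v - w), lorentzLossRate_eq_norm_mul he (w - v), norm_sub_rev]

/-- Linear bound on the flux kernel: `ν(v - w) ≤ |S²| (|v| + |w|)`. [folklore] -/
theorem lorentzLossRate_sub_le (v w : V3) :
    lorentzLossRate (v - w) ≤ sphereMass V3 * (‖v‖ + ‖w‖) :=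
  (lorentzLossRate_le (v - w)).trans (mul_le_mul_of_nonneg_left (norm_sub_le v w) sphereMass_nonneg)

/-- Product integrability of `ν(v - w) p(v) q(w)` on `ℝ³ × ℝ³` for `p`, `q` integrable with finite
first absolute moments (domination by `|S²| (|v| |p(v)| |q(w)| + |p(v)| |w| |q(w)|)`). [folklore] -/
theorem integrable_prod_lossRate {p q : V3 → ℝ} (hp : Integrable p)
    (hp1 : Integrable fun v => ‖v‖ * p v) (hq : Integrable q) (hq1 : Integrable fun w => ‖w‖ * q w) :
    Integrable (fun z : V3 × V3 => lorentzLossRate (z.1 - z.2) * (p z.1 * q z.2))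
      ((volume : Measure V3).prod volume) := by
  have hdom : Integrable (fun z : V3 × V3 => sphereMass V3 *
      (‖‖z.1‖ * p z.1‖ * ‖q z.2‖ + ‖p z.1‖ * ‖‖z.2‖ * q z.2‖)) ((volume : Measure V3).prod volume) :=
    ((hp1.norm.mul_prod hq.norm).add (hp.norm.mul_prod hq1.norm)).const_mul _
  have hc : Continuous fun z : V3 × V3 => lorentzLossRate (z.1 - z.2) :=
    continuous_lorentzLossRate.comp (continuous_fst.sub continuous_snd)
  refine hdom.mono' (hc.aestronglyMeasurable.mul (hp.1.comp_fst.mul hq.1.comp_snd))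
    (Eventually.of_forall fun z => ?_)
  have hν := lorentzLossRate_nonneg (z.1 - z.2)
  have hνle := lorentzLossRate_sub_le z.1 z.2
  rw [norm_mul, Real.norm_of_nonneg hν, norm_mul, norm_mul, norm_mul, norm_norm, norm_norm]
  have h0 : 0 ≤ ‖p z.1‖ * ‖q z.2‖ := mul_nonneg (norm_nonneg _) (norm_nonneg _)
  calc lorentzLossRate (z.1 - z.2) * (‖p z.1‖ * ‖q z.2‖)
      ≤ sphereMass V3 * (‖z.1‖ + ‖z.2‖) * (‖p z.1‖ * ‖q z.2‖) := mul_le_mul_of_nonneg_right hνle h0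
    _ = sphereMass V3 * (‖z.1‖ * ‖p z.1‖ * ‖q z.2‖ + ‖p z.1‖ * (‖z.2‖ * ‖q z.2‖)) := by ring

/-- `∫ ν(v - w) M(w) q(v) dw = q(v) a₁(v)` (`collisionFrequency_eq`). [folklore] -/
theorem integral_lossRate_mul_left (q : V3 → ℝ) (v : V3) :
    ∫ w, lorentzLossRate (v - w) * (q v * maxwellianBeta 1 w) = q v * collisionFrequency 1 v := by
  rw [collisionFrequency_eq, ← integral_const_mul]
  exact integral_congr_ae (Eventually.of_forall fun w => by ring)

/-- `∫ ν(v - w) M(v) q(w) dv = q(w) a₁(w)` (symmetry of `ν` and `collisionFrequency_eq`). [folklore] -/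
theorem integral_lossRate_mul_right (q : V3 → ℝ) (w : V3) :
    ∫ v, lorentzLossRate (v - w) * (maxwellianBeta 1 v * q w) = q w * collisionFrequency 1 w := by
  rw [collisionFrequency_eq, ← integral_const_mul]
  exact integral_congr_ae (Eventually.of_forall fun v => by
    dsimp only; rw [lorentzLossRate_sub_comm]; ring)

/-- **Stub C** (the flux pair correlation is nonpositive on the `π`-centred hyperplane). Given the
negative type of the flux kernel `ν(v - w)` on the mass-zero hyperplane, for every `g` of finite
`a₁ M`-energy with `∫ g a₁ M = 0`:
`∫∫ ν(v - w) (M g)(v) (M g)(w) dv dw ≤ 0`. [folklore] -/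
theorem stub_fluxPairNonpos :
    (∀ φ : V3 → ℝ, Integrable φ → Integrable (fun v => ‖v‖ * φ v) → ∫ v, φ v = 0 →
      ∫ v, ∫ w, (∫ ω, hardSphereKernel (v, w) ω ∂sphereMeasure) * (φ v * φ w) ≤ 0) →
    ∀ g : V3 → ℝ, FiniteEnergy 1 g →
      ∫ v, g v * (collisionFrequency 1 v * maxwellianBeta 1 v) = 0 →
      ∫ v, ∫ w, (∫ ω, hardSphereKernel (v, w) ω ∂sphereMeasure) *
          ((maxwellianBeta 1 v * g v) * (maxwellianBeta 1 w * g w)) ≤ 0 := by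
  intro hneg g hg hmean
  -- ingredients at `β = 1`, `d = Fin 3`
  have hd3 : 2 ≤ Fintype.card (Fin 3) := by simp
  have hMpos : ∀ v : V3, 0 < maxwellianBeta 1 v := maxwellianBeta_pos one_pos
  have I0 : Integrable (maxwellianBeta (d := Fin 3) 1) := integrable_maxwellianBeta one_pos
  have I1 : Integrable fun v : V3 => ‖v‖ * maxwellianBeta 1 v := by
    simpa only [pow_one] using integrable_pow_norm_mul_maxwellianBeta (d := Fin 3) one_pos 1
  have I3 : Integrable fun v => collisionFrequency 1 v * g v * maxwellianBeta 1 v :=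
    integrable_collisionFrequency_mul_mul_maxwellianBeta one_pos hg
  -- `p = M g`
  obtain ⟨p, hp⟩ : ∃ p : V3 → ℝ, p = fun v => maxwellianBeta 1 v * g v := ⟨_, rfl⟩
  have hp' : ∀ v, p v = maxwellianBeta 1 v * g v := fun v => by rw [hp]
  have I2 : Integrable p := by
    rw [hp]
    exact (integrable_mul_maxwellianBeta_of_finiteEnergy hd3 one_pos hg).congr
      (Eventually.of_forall fun v => mul_comm (g v) (maxwellianBeta 1 v))
  have I5 : Integrable fun v : V3 => ‖v‖ * p v := by
    obtain ⟨a₀, -, c, hc, hlow⟩ := exists_collisionFrequency_lowerBound (d := Fin 3) hd3 one_pos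
    refine (I3.norm.const_mul c⁻¹).mono' (continuous_norm.aestronglyMeasurable.mul I2.1)
      (Eventually.of_forall fun v => ?_)
    have hM := (hMpos v).le
    have ha := TaggedLinearBoltzmannSeries.collisionFrequency_nonneg one_pos v
    rw [hp', norm_mul, norm_norm, norm_mul, Real.norm_of_nonneg hM, norm_mul, norm_mul,
      Real.norm_of_nonneg ha, Real.norm_of_nonneg hM]
    have hk : 0 ≤ maxwellianBeta 1 v * ‖g v‖ := mul_nonneg hM (norm_nonneg _)
    calc ‖v‖ * (maxwellianBeta 1 v * ‖g v‖)
        = c⁻¹ * (c * ‖v‖) * (maxwellianBeta 1 v * ‖g v‖) := by rw [inv_mul_cancel_left₀ hc.ne']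
      _ ≤ c⁻¹ * collisionFrequency 1 v * (maxwellianBeta 1 v * ‖g v‖) :=
          mul_le_mul_of_nonneg_right (mul_le_mul_of_nonneg_left (hlow v).2 (inv_nonneg.2 hc.le)) hk
      _ = c⁻¹ * (collisionFrequency 1 v * ‖g v‖ * maxwellianBeta 1 v) := by ring
  -- the test function `φ = p - m M`, `m = ∫ p`
  obtain ⟨m, hm⟩ : ∃ m : ℝ, m = ∫ v, p v := ⟨_, rfl⟩
  obtain ⟨φ, hφ⟩ : ∃ φ : V3 → ℝ, φ = fun v => p v - m * maxwellianBeta 1 v := ⟨_, rfl⟩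
  have hφ' : ∀ v, φ v = p v - m * maxwellianBeta 1 v := fun v => by rw [hφ]
  have hφi : Integrable φ := by rw [hφ]; exact I2.sub (I0.const_mul m)
  have hφ1 : Integrable fun v => ‖v‖ * φ v := by
    have : (fun v => ‖v‖ * φ v) = fun v => ‖v‖ * p v - m * (‖v‖ * maxwellianBeta 1 v) := by
      funext v; rw [hφ']; ring
    rw [this]
    exact I5.sub (I1.const_mul m)
  have hφ0 : ∫ v, φ v = 0 := by
    simp_rw [hφ']
    rw [integral_sub I2 (I0.const_mul m), integral_const_mul, integral_maxwellianBeta one_pos, ← hm]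
    ring
  -- negative type applied to `φ`
  have H := hneg φ hφi hφ1 hφ0
  simp only [integral_hardSphereKernel] at H ⊢
  -- product integrability
  have PF := integrable_prod_lossRate hφi hφ1 hφi hφ1
  have P1 := integrable_prod_lossRate I2 I5 I2 I5
  have P2 := integrable_prod_lossRate I2 I5 I0 I1
  have P3 := integrable_prod_lossRate I0 I1 I2 I5
  have P4 := integrable_prod_lossRate I0 I1 I0 I1
  have P2m := P2.const_mul m
  have P3m := P3.const_mul m
  have P4m := P4.const_mul (m ^ 2)
  have P12 : Integrable (fun z : V3 × V3 => lorentzLossRate (z.1 - z.2) * (p z.1 * p z.2) -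
      m * (lorentzLossRate (z.1 - z.2) * (p z.1 * maxwellianBeta 1 z.2)))
      ((volume : Measure V3).prod volume) := P1.sub P2m
  have P123 : Integrable (fun z : V3 × V3 => lorentzLossRate (z.1 - z.2) * (p z.1 * p z.2) -
      m * (lorentzLossRate (z.1 - z.2) * (p z.1 * maxwellianBeta 1 z.2)) -
      m * (lorentzLossRate (z.1 - z.2) * (maxwellianBeta 1 z.1 * p z.2)))
      ((volume : Measure V3).prod volume) := P12.sub P3m
  -- `H` as a product integral, expanded
  have H' : ∫ z, lorentzLossRate (z.1 - z.2) * (φ z.1 * φ z.2) ∂((volume : Measure V3).prod volume)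
      ≤ 0 := by
    rw [integral_prod _ PF]; exact H
  have Hsplit : ∫ z, lorentzLossRate (z.1 - z.2) * (φ z.1 * φ z.2) ∂((volume : Measure V3).prod volume)
      = (((∫ z, lorentzLossRate (z.1 - z.2) * (p z.1 * p z.2) ∂((volume : Measure V3).prod volume))
          - m * ∫ z, lorentzLossRate (z.1 - z.2) * (p z.1 * maxwellianBeta 1 z.2)
            ∂((volume : Measure V3).prod volume))
          - m * ∫ z, lorentzLossRate (z.1 - z.2) * (maxwellianBeta 1 z.1 * p z.2)
            ∂((volume : Measure V3).prod volume))
          + m ^ 2 * ∫ z, lorentzLossRate (z.1 - z.2) * (maxwellianBeta 1 z.1 * maxwellianBeta 1 z.2)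
            ∂((volume : Measure V3).prod volume) := by
    rw [← integral_const_mul, ← integral_const_mul, ← integral_const_mul, ← integral_sub P1 P2m,
      ← integral_sub P12 P3m, ← integral_add P123 P4m]
    refine integral_congr_ae (Eventually.of_forall fun z => ?_)
    dsimp only
    rw [hφ', hφ']
    ring
  -- the cross terms vanish
  have T2 : ∫ z, lorentzLossRate (z.1 - z.2) * (p z.1 * maxwellianBeta 1 z.2)
      ∂((volume : Measure V3).prod volume) = 0 := by
    rw [integral_prod _ P2]
    show ∫ v, ∫ w, lorentzLossRate (v - w) * (p v * maxwellianBeta 1 w) = 0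
    simp_rw [integral_lossRate_mul_left]
    rw [← hmean]
    exact integral_congr_ae (Eventually.of_forall fun v => by dsimp only; rw [hp']; ring)
  have T3 : ∫ z, lorentzLossRate (z.1 - z.2) * (maxwellianBeta 1 z.1 * p z.2)
      ∂((volume : Measure V3).prod volume) = 0 := by
    have P3' : Integrable (fun z : V3 × V3 => lorentzLossRate (z.2 - z.1) * (maxwellianBeta 1 z.2 * p z.1))
        ((volume : Measure V3).prod volume) := P3.swap
    rw [← integral_prod_swap]
    simp only [Prod.fst_swap, Prod.snd_swap]
    rw [integral_prod _ P3']
    show ∫ w, ∫ v, lorentzLossRate (v - w) * (maxwellianBeta 1 v * p w) = 0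
    simp_rw [integral_lossRate_mul_right]
    rw [← hmean]
    exact integral_congr_ae (Eventually.of_forall fun v => by dsimp only; rw [hp']; ring)
  -- the `M ⊗ M` term is nonnegative
  have T4 : 0 ≤ ∫ z, lorentzLossRate (z.1 - z.2) * (maxwellianBeta 1 z.1 * maxwellianBeta 1 z.2)
      ∂((volume : Measure V3).prod volume) :=
    integral_nonneg fun z => mul_nonneg (lorentzLossRate_nonneg _)
      (mul_nonneg (hMpos _).le (hMpos _).le)
  -- the goal as a product integral
  have hgoal : ∫ v, ∫ w, lorentzLossRate (v - w) *
      ((maxwellianBeta 1 v * g v) * (maxwellianBeta 1 w * g w)) =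
      ∫ z, lorentzLossRate (z.1 - z.2) * (p z.1 * p z.2) ∂((volume : Measure V3).prod volume) := by
    rw [integral_prod _ P1, hp]
  rw [hgoal]
  rw [Hsplit, T2, T3] at H'
  nlinarith [H', mul_nonneg (sq_nonneg m) T4]

end Summit.AtomisticToContinuum.HydrodynamicLimit.Theorems.SpectralContractionRLine.FluxPair

end
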